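import Literature.AlgebraicGeometry.Resolution.LogRegularFreeStalk
import HarnessLib

/-!
# Crux `FrobeniusLadder.FRationalResolution` (stmt-ResolutionOfSingularities-15317), line `redirect`,
# stub `stub_diagonalizableQuotientResolution` — at a «fixed» point of full dimension the Kato ideal localizes to the
# maximal ideal (hypothesis `hI𝔮` of the assemblies (ε₁)/(ε₁′), from Kato (2.1) alone)

`…PrimaryCentreAtIsolatedPointFan.exists_primary_monomialCentre_of_isolated'` asks that every `r ∈ 𝔮` have `u r ∈ I(𝔮)` for some
`u ∉ 𝔮` (the Kato ideal `I(𝔮) = (φ(P ∖ 0))` generates `𝔮 A_𝔮`). When the unit face at `𝔮` is trivial (`φ(P ∖ 0) ⊆ 𝔮`) and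
`dim A_𝔮 = n` (the case of a `D(A)`-fixed point: `dim (S₀)_𝔮 = dim S_𝔔 = n`, tree `…FixedPointDimension`), Kato's condition
(2.1) gives `dim A_𝔮/I(𝔮) = dim A_𝔮 − n = 0` with `A_𝔮/I(𝔮)` regular, i.e. a field, so `I(𝔮) A_𝔮 = 𝔮 A_𝔮`.

* **`LogChart.exists_mul_mem_ideal_of_isLogRegularAt_of_ringKrullDim_eq`** — the statement.

Honest label: dictionary (no stub closed). No definitions, no named facts, no sorry. [cite: Kato1994, Def. (2.1)]
-/

noncomputable section

namespace Literature.AlgebraicGeometry.Resolution.LogChart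

open IsLocalRing

universe v

variable {A : Type v} [CommRing A] [IsNoetherianRing A] {n : ℕ} {P : AddSubmonoid (Fin n → ℤ)}
  {φ : Multiplicative P →* A} {𝔮 : Ideal A} [𝔮.IsPrime]

/-- **Kato's ideal generates the maximal ideal at a fixed point of full dimension.** If `φ : P → A` is log regular at `𝔮`,
`φ(P ∖ 0) ⊆ 𝔮` and `dim A_𝔮 = n`, then `I(𝔮) A_𝔮 = 𝔮 A_𝔮`; elementwise: every `r ∈ 𝔮` has `u · r ∈ I(𝔮)` for some `u ∉ 𝔮`.
[cite: Kato1994, Def. (2.1)] -/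
theorem exists_mul_mem_ideal_of_isLogRegularAt_of_ringKrullDim_eq (hreg : IsLogRegularAt P φ 𝔮)
    (hfix : ∀ p : P, (p : Fin n → ℤ) ≠ 0 → φ (Multiplicative.ofAdd p) ∈ 𝔮)
    (hdim : ringKrullDim (Localization.AtPrime 𝔮) = n) :
    ∀ r ∈ 𝔮, ∃ u ∉ 𝔮, u * r ∈ ideal P φ 𝔮 := by
  classical
  set R := Localization.AtPrime 𝔮 with hR
  set I : Ideal R := (ideal P φ 𝔮).map (algebraMap A R) with hI
  obtain ⟨hquot, hd⟩ := hreg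
  haveI := hquot
  -- the unit face is `{0}`
  have h1 : φ (Multiplicative.ofAdd (0 : P)) ∉ 𝔮 := by
    rw [ofAdd_zero, map_one]
    exact fun h => ‹𝔮.IsPrime›.ne_top (Ideal.eq_top_of_isUnit_mem _ h isUnit_one)
  have hface : ((fun p : P => (p : Fin n → ℤ)) '' face P φ 𝔮) = {0} := by
    ext v
    simp only [Set.mem_image, mem_face_iff, Set.mem_singleton_iff]
    constructor
    · rintro ⟨p, hp, rfl⟩
      by_contra h0
      exact hp (hfix p h0)
    · rintro rfl
      exact ⟨0, h1, rfl⟩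
  rw [hface, Submodule.span_singleton_eq_bot.2 rfl, finrank_bot, Nat.sub_zero, hdim] at hd
  -- `dim (R/I) = 0`
  have hRI : ((maximalIdeal (R ⧸ I)).spanFinrank : WithBot ℕ∞) = ringKrullDim (R ⧸ I) := (isRegularLocalRing_iff _).mp hquot
  rw [← hRI] at hd
  have h0 : (maximalIdeal (R ⧸ I)).spanFinrank = 0 := by
    have h2 : (((maximalIdeal (R ⧸ I)).spanFinrank + n : ℕ) : WithBot ℕ∞) = ((0 + n : ℕ) : WithBot ℕ∞) := by
      push_cast; rw [zero_add]; exact hd.symm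
    have := (Nat.cast_injective (R := WithBot ℕ∞)) h2
    omega
  -- hence `R/I` is a field and `I` is the maximal ideal
  have hbot : maximalIdeal (R ⧸ I) = ⊥ := by
    have hfg : (maximalIdeal (R ⧸ I)).FG := IsNoetherian.noetherian _
    rwa [← Submodule.spanFinrank_eq_zero_iff_eq_bot hfg]
  have hImax : I = maximalIdeal R := by
    have hfield : IsField (R ⧸ I) := (IsLocalRing.isField_iff_maximalIdeal_eq).2 hbot
    haveI : I.IsMaximal := Ideal.Quotient.maximal_of_isField _ hfield
    exact IsLocalRing.eq_maximalIdeal inferInstance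
  -- elementwise
  intro r hr
  have hrI : algebraMap A R r ∈ I := by
    rw [hImax, ← Localization.AtPrime.map_eq_maximalIdeal]
    exact Ideal.mem_map_of_mem _ hr
  rw [hI, IsLocalization.mem_map_algebraMap_iff 𝔮.primeCompl] at hrI
  obtain ⟨⟨⟨a, ha⟩, s⟩, hs⟩ := hrI
  obtain ⟨c, hc⟩ := (IsLocalization.eq_iff_exists 𝔮.primeCompl R).1
    (show algebraMap A R (r * s) = algebraMap A R a by rw [map_mul]; exact hs)
  refine ⟨c * s, fun h => (‹𝔮.IsPrime›.mem_or_mem h).elim c.2 s.2, ?_⟩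
  have : (c : A) * (s : A) * r = c * a := by rw [mul_assoc, mul_comm (s : A) r]; exact hc
  rw [this]
  exact Ideal.mul_mem_left _ _ ha

end Literature.AlgebraicGeometry.Resolution.LogChart

end
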